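import Summits.QuantumAdvantage.AdviceFreeQNC0.SeparableLDMA
import Summits.QuantumAdvantage.AdviceFreeQNC0.ProductGameSmallBlocks
import HarnessLib

/-!
# Cell qa-qnc0 (rung F-Q1, route RingFrame, crux α, line `product`): LDMA for maps of LOW
# SYNDROME RANK (planner qa-qnc0-p1 TARGET §20.7(e)(i), ask P6b `ldma_of_low_syndrome_rank`)

The potential cost `distFail D z = dist(z, 𝓕_{L'}(D))` of a row depends on the row only modulo the
linear part `C = 𝓕 ⊕ 𝓕` of the (affine) fail family: `dist(z ⊕ F₁ ⊕ F₂, 𝓕) = dist(z, 𝓕)` for fail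
patterns `F₁, F₂` (`distFail_xor_failDiff`, from `isElimFail_xor3`).  Hence if the rows of `Γ`
are determined MODULO `C` by `t` Boolean coordinates `q₁,…,q_t` of degree `≤ d` ("syndrome rank
`≤ t`": `Γ u = Φ(q₁ u, …, q_t u) ⊕ F₁(u) ⊕ F₂(u)`), then `u ↦ distFail D (Γ u)` factors through the
syndrome map `Q = (q_k)`, whose fibres `{Q = y}` are supports of the degree-`≤ t·d` polynomials
`Π_k [q_k = y_k]` (`fibre_mem_lowDeg`), and `separable_weighted_avoidance` (PLDAMS part by part,
p443768 + p437365) gives LDMA: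

* `ldma_of_low_syndrome_rank`: there is an absolute `κ > 0` such that for every `C`, all large
  `L, L'`, every `D`, every `Γ` of syndrome rank `t` through degree-`d` coordinates with
  `t·d ≤ (log₂ min(L,L'))^C`, and every `r`: `κ·Σ_u distFail D (Γ u) ≤ Σ_{|u|≡r} distFail D (Γ u)`.

This is "separable modulo `C`" (rows need not repeat, only their cosets do) and is not contained
in `ldmaPolylog_separable` as stated.  No column-degree hypothesis on `Γ` is needed.
WHAT THIS IS NOT: nothing for general column-degree-`D` maps (syndrome rank up to `L`: the crux);
α untouched; no separation claim.
-/

noncomputable section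

namespace Summit.QuantumAdvantage.AdviceFreeQNC0

open Finset
open Literature.Computability.MetaComplexity Literature.Computability.MetaComplexity.Smolensky

variable {L ℓ : ℕ}

/-! ### `C`-invariance of the potential cost -/

/-- One direction: translating a row by the sum of two fail patterns does not increase its
potential cost. -/
theorem distFail_xor_failDiff_le {D : ℕ} (z : (Fin ℓ → Bool) → Bool)
    {F₁ F₂ : (Fin ℓ → Bool) → Bool} (h₁ : IsElimFail D F₁) (h₂ : IsElimFail D F₂) :
    distFail D (fun v => xor (z v) (xor (F₁ v) (F₂ v))) ≤ distFail D z := by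
  obtain ⟨F, hF, e⟩ := exists_distFail_eq D z
  rw [← e]
  refine le_trans (distFail_le _ (isElimFail_xor3 hF h₁ h₂)) (le_of_eq ?_)
  unfold hdist
  congr 1
  ext v
  simp only [mem_filter, mem_univ, true_and]
  cases z v <;> cases F v <;> cases F₁ v <;> cases F₂ v <;> decide

/-- **`dist(z ⊕ F₁ ⊕ F₂, 𝓕) = dist(z, 𝓕)`** for fail patterns `F₁, F₂`: the potential cost is
invariant under the linear part `C = 𝓕 ⊕ 𝓕` of the fail family (`𝓕 ⊕ 𝓕 ⊕ 𝓕 = 𝓕`). -/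
theorem distFail_xor_failDiff {D : ℕ} (z : (Fin ℓ → Bool) → Bool)
    {F₁ F₂ : (Fin ℓ → Bool) → Bool} (h₁ : IsElimFail D F₁) (h₂ : IsElimFail D F₂) :
    distFail D (fun v => xor (z v) (xor (F₁ v) (F₂ v))) = distFail D z := by
  refine le_antisymm (distFail_xor_failDiff_le z h₁ h₂) ?_
  have h := distFail_xor_failDiff_le (D := D) (fun v => xor (z v) (xor (F₁ v) (F₂ v))) h₁ h₂
  have heq : (fun v => xor (xor (z v) (xor (F₁ v) (F₂ v))) (xor (F₁ v) (F₂ v))) = z := by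
    funext v
    cases z v <;> cases F₁ v <;> cases F₂ v <;> decide
  rw [heq] at h
  exact h

/-! ### Fibres of a low-degree syndrome map are low-degree sets -/

/-- The indicator of one value `[f u = β]` of a degree-`≤ d` Boolean function has degree `≤ d`. -/
theorem boolValue_mem_lowDeg {d : ℕ} {f : (Fin L → Bool) → Bool} (hf : HasDeg f d) (β : Bool) :
    (fun u : Fin L → Bool => if f u = β then (1 : ZMod 2) else 0) ∈ lowDeg (ZMod 2) L d := by
  unfold HasDeg at hf
  cases β with
  | true => exact hf
  | false =>
    have heq : (fun u : Fin L → Bool => if f u = false then (1 : ZMod 2) else 0) =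
        1 + fun u => if f u = true then (1 : ZMod 2) else 0 := by
      funext u
      simp only [Pi.add_apply, Pi.one_apply]
      cases f u <;> decide
    rw [heq]
    have h1 : (1 : CubeFn (ZMod 2) L) ∈ lowDeg (ZMod 2) L d := by
      rw [← mono_empty]; exact mono_mem_lowDeg (by simp)
    exact Submodule.add_mem _ h1 hf

/-- **Fibres of the syndrome map have degree `≤ t·d`**: the indicator of
`{u : (q_k u)_k = y}` is the product of the `t` value indicators `[q_k u = y_k]`. -/
theorem fibre_mem_lowDeg {t d : ℕ} (q : Fin t → (Fin L → Bool) → Bool)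
    (hq : ∀ k, HasDeg (q k) d) (y : Fin t → Bool) :
    (fun u : Fin L → Bool => if (fun k => q k u) = y then (1 : ZMod 2) else 0) ∈
      lowDeg (ZMod 2) L (t * d) := by
  classical
  have heq : (fun u : Fin L → Bool => if (fun k => q k u) = y then (1 : ZMod 2) else 0) =
      ∏ k : Fin t, (fun u : Fin L → Bool => if q k u = y k then (1 : ZMod 2) else 0) := by
    funext u
    rw [Finset.prod_apply]
    by_cases h : (fun k => q k u) = y
    · rw [if_pos h]
      symm
      exact Finset.prod_eq_one fun k _ => by rw [if_pos (congrFun h k)]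
    · rw [if_neg h]
      obtain ⟨k, hk⟩ : ∃ k, q k u ≠ y k := not_forall.mp fun hall => h (funext hall)
      symm
      exact Finset.prod_eq_zero (Finset.mem_univ k) (by rw [if_neg hk])
  rw [heq]
  have h := prod_mem_lowDeg_mul (univ : Finset (Fin t))
    (fun k => fun u : Fin L → Bool => if q k u = y k then (1 : ZMod 2) else 0)
    (fun k _ => boolValue_mem_lowDeg (hq k) (y k))
  rw [Finset.card_univ, Fintype.card_fin] at h
  exact h

/-! ### LDMA for low syndrome rank -/

/-- **LDMA holds for maps of low syndrome rank** (TARGET §20.7(e)(i), P6b): there is an absolute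
`κ > 0` such that for every `C`, all large `L, L'`, every `D`, every map `Γ` whose rows are
determined modulo `𝓕 ⊕ 𝓕` by `t` Boolean coordinates of degree `≤ d` with
`t·d ≤ (log₂ min(L,L'))^C` — `Γ u = Φ (q₁ u, …, q_t u) ⊕ F₁ ⊕ F₂` with `F₁, F₂ ∈ 𝓕_{L'}(D)`
depending on `u` — and every residue `r`:
`κ · Σ_u distFail D (Γ u) ≤ Σ_{|u| ≡ r (3)} distFail D (Γ u)`.
(Cell statement; from `separable_weighted_avoidance` on the fibres of the syndrome map and the
`C`-invariance `distFail_xor_failDiff`.) [cite: Srinivasan2023, Lemma 3.1] -/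
theorem ldma_of_low_syndrome_rank :
    ∃ κ : ℝ, 0 < κ ∧ ∀ C : ℕ, ∃ L₀ : ℕ, ∀ L L' : ℕ, L₀ ≤ L → L₀ ≤ L' → ∀ D : ℕ,
      ∀ Γ : (Fin L → Bool) → (Fin L' → Bool) → Bool,
      (∃ t d : ℕ, ∃ q : Fin t → (Fin L → Bool) → Bool,
        ∃ Φ : (Fin t → Bool) → (Fin L' → Bool) → Bool,
        (∀ k, HasDeg (q k) d) ∧ t * d ≤ (Nat.log 2 (min L L')) ^ C ∧
        ∀ u, ∃ F₁ F₂ : (Fin L' → Bool) → Bool, IsElimFail D F₁ ∧ IsElimFail D F₂ ∧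
          ∀ v, Γ u v = xor (Φ (fun k => q k u) v) (xor (F₁ v) (F₂ v))) →
      ∀ r : ℕ,
        κ * ((∑ u : Fin L → Bool, distFail D (Γ u) : ℕ) : ℝ) ≤
          ((∑ u ∈ univ.filter (fun u : Fin L → Bool => wt u % 3 = r % 3),
            distFail D (Γ u) : ℕ) : ℝ) := by
  classical
  obtain ⟨κ, hκ, hS⟩ := separable_weighted_avoidance
  refine ⟨κ, hκ, fun C => ?_⟩
  obtain ⟨L₀, hL₀⟩ := hS C
  refine ⟨L₀, fun L L' hL _ D Γ hΓ r => ?_⟩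
  obtain ⟨t, d, q, Φ, hq, htd, hrows⟩ := hΓ
  -- the syndrome map and its relabelling by `Fin (2^t)`
  set Q : (Fin L → Bool) → (Fin t → Bool) := fun u k => q k u with hQ
  set e := Fintype.equivFin (Fin t → Bool) with he
  set π : (Fin L → Bool) → Fin (Fintype.card (Fin t → Bool)) := fun u => e (Q u) with hπ
  -- the parts are fibres of `Q`, supports of degree-`≤ (log₂ L)^C` polynomials
  have hparts : ∀ s : Fin (Fintype.card (Fin t → Bool)), ∃ g : CubeFn (ZMod 2) L,
      g ∈ lowDeg (ZMod 2) L ((Nat.log 2 L) ^ C) ∧ ∀ u, g u ≠ 0 ↔ π u = s := by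
    intro s
    refine ⟨fun u => if (fun k => q k u) = e.symm s then (1 : ZMod 2) else 0, ?_, fun u => ?_⟩
    · have hdeg : t * d ≤ (Nat.log 2 L) ^ C :=
        htd.trans (Nat.pow_le_pow_left (Nat.log_mono_right (min_le_left _ _)) C)
      exact lowDeg_mono hdeg (fibre_mem_lowDeg q hq (e.symm s))
    · have hiff : (fun k => q k u) = e.symm s ↔ π u = s := by
        rw [hπ]
        constructor
        · intro h
          show e (Q u) = s
          rw [hQ]
          show e (fun k => q k u) = s
          rw [h, Equiv.apply_symm_apply]
        · intro h
          have h' : e (fun k => q k u) = s := h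
          rw [← h', Equiv.symm_apply_apply]
      by_cases h : (fun k => q k u) = e.symm s
      · simp only [if_pos h, ne_eq, one_ne_zero, not_false_eq_true, true_iff]
        exact hiff.1 h
      · simp only [if_neg h, ne_eq, not_true_eq_false, false_iff]
        exact fun hs => h (hiff.2 hs)
  -- the potential cost factors through `π`
  set φ : Fin (Fintype.card (Fin t → Bool)) → ℕ := fun s => distFail D (Φ (e.symm s)) with hφ
  have hcost : ∀ u, distFail D (Γ u) = φ (π u) := by
    intro u
    obtain ⟨F₁, F₂, hF₁, hF₂, hu⟩ := hrows u
    have hΓu : Γ u = fun v => xor (Φ (fun k => q k u) v) (xor (F₁ v) (F₂ v)) := funext hu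
    rw [hΓu, distFail_xor_failDiff _ hF₁ hF₂, hφ]
    show distFail D (Φ (fun k => q k u)) = distFail D (Φ (e.symm (e (Q u))))
    rw [Equiv.symm_apply_apply]
  have h := hL₀ L hL (Fintype.card (Fin t → Bool)) π hparts φ r
  have h1 : (∑ u : Fin L → Bool, distFail D (Γ u)) = ∑ u : Fin L → Bool, φ (π u) :=
    Finset.sum_congr rfl fun u _ => hcost u
  have h2 : (∑ u ∈ univ.filter (fun u : Fin L → Bool => wt u % 3 = r % 3), distFail D (Γ u)) =
      ∑ u ∈ univ.filter (fun u : Fin L → Bool => wt u % 3 = r % 3), φ (π u) :=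
    Finset.sum_congr rfl fun u _ => hcost u
  rw [h1, h2]
  exact h

end Summit.QuantumAdvantage.AdviceFreeQNC0

end
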